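import Mathlib.Analysis.Complex.CauchyIntegral
import Mathlib.Analysis.Analytic.IsolatedZeros
import Mathlib.Analysis.Analytic.Polynomial
import Mathlib.Analysis.SpecialFunctions.Complex.Analytic
import Mathlib.Analysis.SpecialFunctions.Complex.LogDeriv
import Mathlib.Analysis.Calculus.InverseFunctionTheorem.Analytic
import Mathlib.Analysis.Calculus.Deriv.Inv
import Mathlib.Topology.Order.IntermediateValue
import Mathlib.Order.Interval.Set.Infinite
import Literature.Analysis.ODE.PainleveFirstOrder
import Literature.Analysis.ODE.PainleveFirstOrderCauchy
import Literature.Analysis.ODE.PainleveFirstOrderAlgebra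
import HarnessLib

/-!
# Proof of Painlevé's theorem `painleve_firstOrder_firstDegree` (Hille 1969, Thm. 12.1.1)

This file discharges the named fact `Literature.Analysis.ODE.painleve_firstOrder_firstDegree`
(`PainleveFirstOrder.lean`) following the printed proof in E. Hille, *Lectures on Ordinary
Differential Equations* (1969), §12.1:

1. (`radial_trichotomy`) along the radius ending at the boundary point `ζ`, the solution either
   tends to a finite limit, or tends to `∞`, or has a cluster value `A` which is not a root of
   `Q(ζ, ·)` (Hille's exclusion of "Case 6": the values cannot oscillate without accumulating at
   a point of the region `Δ_δ` where `f = P/Q` is holomorphic);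
2. (`extension_of_regular_clusterPt`, Hille "Case 1"/"Theorem of Painlevé") at a cluster value
   where `Q ≠ 0` the solution is holomorphic at `ζ`, by Cauchy's existence theorem with a
   radius of holomorphy uniform in the initial point (`PainleveFirstOrderCauchy.lean`) and
   uniqueness;
3. (`branch_representation`, Hille "Case 2", (12.1.6)–(12.1.8)) at a limit `w₁` with
   `Q(ζ, w₁) = 0 ≠ P(ζ, w₁)` one integrates the reciprocal equation `dz/dw = Q/P`, factors
   `z - ζ = (w - w₁)^k φ(w)` and inverts: `w = H((z - ζ)^{1/k})`;
4. ("Case 5", `w → ∞`) the substitution `w = 1/v` and the transformed equation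
   (`PainleveFirstOrderAlgebra.lean`, (12.1.14)) reduce to 2 or 3 at `(ζ, 0)`, giving a pole or an
   algebraic infinitude;
5. (`representation_of_tail`) the expansion found along the radius is propagated to the lens
   `ball c r ∩ ball ζ ε` by the identity theorem.

The fixed singular set `S` is the finite set of `fixedSingular_package`.

## References

* E. Hille, *Lectures on Ordinary Differential Equations*, Addison-Wesley 1969, §12.1,
  Thm. 12.1.1 and its proof. [cite: Hille1969, §12.1 Thm. 12.1.1]
* E. L. Ince, *Ordinary Differential Equations* (1926), §§12.5, 13.6.
* P. Painlevé, *Sur les lignes singulières des fonctions analytiques*, Ann. Fac. Sci. Toulouse 2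
  (1888).
-/

noncomputable section

namespace Literature.Analysis.ODE

open _root_.Complex Metric Set Filter
open scoped Topology

/-! ### The radius `s ↦ c + s (ζ - c)` ending at the boundary point `ζ` -/

section Geometry

variable {c ζ : ℂ} {r : ℝ}

/-- `(c + s(ζ - c)) - c = s (ζ - c)`. [folklore] -/
theorem radial_sub_center (s : ℝ) : c + (s : ℂ) * (ζ - c) - c = (s : ℂ) * (ζ - c) := by ring

/-- `ζ - (c + s(ζ - c)) = (1 - s)(ζ - c)`. [folklore] -/
theorem zeta_sub_radial (s : ℝ) : ζ - (c + (s : ℂ) * (ζ - c)) = ((1 - s : ℝ) : ℂ) * (ζ - c) := by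
  push_cast
  ring

/-- `‖(c + s(ζ - c)) - c‖ = s r`. [folklore] -/
theorem norm_radial_sub_center (hζ : ‖ζ - c‖ = r) {s : ℝ} (hs : 0 ≤ s) :
    ‖c + (s : ℂ) * (ζ - c) - c‖ = s * r := by
  rw [radial_sub_center, norm_mul, Complex.norm_real, Real.norm_eq_abs, abs_of_nonneg hs, hζ]

/-- `‖ζ - (c + s(ζ - c))‖ = (1 - s) r`. [folklore] -/
theorem norm_zeta_sub_radial (hζ : ‖ζ - c‖ = r) {s : ℝ} (hs : s ≤ 1) :
    ‖ζ - (c + (s : ℂ) * (ζ - c))‖ = (1 - s) * r := by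
  rw [zeta_sub_radial, norm_mul, Complex.norm_real, Real.norm_eq_abs,
    abs_of_nonneg (by linarith), hζ]

/-- Points of the radius with parameter in `[0, 1)` lie in the disc. [folklore] -/
theorem radial_mem_ball (hζ : ‖ζ - c‖ = r) (hr : 0 < r) {s : ℝ} (hs : s ∈ Ico (0 : ℝ) 1) :
    c + (s : ℂ) * (ζ - c) ∈ ball c r := by
  rw [mem_ball, dist_eq_norm, norm_radial_sub_center hζ hs.1]
  nlinarith [hs.2]

/-- Points of the radius with parameter in `(1 - ε/r, 1]` lie in `ball ζ ε`. [folklore] -/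
theorem radial_mem_ball_zeta (hζ : ‖ζ - c‖ = r) (hr : 0 < r) {ε s : ℝ} (hs1 : s ≤ 1)
    (hs : 1 - ε / r < s) : c + (s : ℂ) * (ζ - c) ∈ ball ζ ε := by
  rw [mem_ball, dist_eq_norm, ← norm_neg, neg_sub, norm_zeta_sub_radial hζ hs1]
  have h : (1 - s) < ε / r := by linarith
  calc (1 - s) * r < ε / r * r := by gcongr
    _ = ε := div_mul_cancel₀ ε hr.ne'

/-- The radius approaches `ζ` from inside the slit disc: `(ζ - z)/(ζ - c) = 1 - s > 0`.
[folklore] -/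
theorem radial_div_eq (hζc : ζ ≠ c) (s : ℝ) :
    (ζ - (c + (s : ℂ) * (ζ - c))) / (ζ - c) = ((1 - s : ℝ) : ℂ) := by
  rw [zeta_sub_radial, mul_div_assoc, div_self (sub_ne_zero.mpr hζc), mul_one]

/-- The points of the radius (parameter `< 1`) lie in the slit region at `ζ`. [folklore] -/
theorem radial_div_mem_slitPlane (hζc : ζ ≠ c) {s : ℝ} (hs : s < 1) :
    (ζ - (c + (s : ℂ) * (ζ - c))) / (ζ - c) ∈ slitPlane := by
  rw [radial_div_eq hζc]
  exact Complex.ofReal_mem_slitPlane.mpr (by linarith)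

/-- The radius is continuous in the parameter. [folklore] -/
theorem continuous_radial : Continuous fun s : ℝ => c + (s : ℂ) * (ζ - c) := by fun_prop

/-- The radius tends to `ζ` as `s → 1⁻`. [folklore] -/
theorem tendsto_radial : Tendsto (fun s : ℝ => c + (s : ℂ) * (ζ - c)) (𝓝[<] 1) (𝓝 ζ) := by
  have h : Tendsto (fun s : ℝ => c + (s : ℂ) * (ζ - c)) (𝓝 1) (𝓝 (c + ((1 : ℝ) : ℂ) * (ζ - c))) :=
    continuous_radial.tendsto 1
  simp only [Complex.ofReal_one, one_mul, add_sub_cancel] at h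
  exact h.mono_left nhdsWithin_le_nhds

/-- The radius is injective in the parameter (`ζ ≠ c`). [folklore] -/
theorem radial_injective (hζc : ζ ≠ c) : Function.Injective fun s : ℝ => c + (s : ℂ) * (ζ - c) := by
  intro s t hst
  have h : (s : ℂ) * (ζ - c) = (t : ℂ) * (ζ - c) := add_left_cancel hst
  exact_mod_cast mul_right_cancel₀ (sub_ne_zero.mpr hζc) h

/-- The radius reaches `ζ` only at parameter `1`. [folklore] -/
theorem radial_ne_zeta (hζc : ζ ≠ c) {s : ℝ} (hs : s ≠ 1) : c + (s : ℂ) * (ζ - c) ≠ ζ := by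
  intro h
  have h1 : ζ - (c + (s : ℂ) * (ζ - c)) = 0 := by rw [h, sub_self]
  rw [zeta_sub_radial, mul_eq_zero] at h1
  rcases h1 with h1 | h1
  · have : (1 - s : ℝ) = 0 := by exact_mod_cast h1
    exact hs (by linarith)
  · exact hζc (sub_eq_zero.mp h1)

/-- "Eventually as `s → 1⁻`" unpacked: a terminal interval `[b, 1)` beyond a given `a < 1`.
[folklore] -/
theorem exists_Ico_of_eventually_nhdsLT {p : ℝ → Prop} (h : ∀ᶠ s in 𝓝[<] (1 : ℝ), p s) {a : ℝ}
    (ha : a < 1) : ∃ b, a ≤ b ∧ b < 1 ∧ ∀ s ∈ Ico b 1, p s := by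
  obtain ⟨b₀, hb₀, hb⟩ := (nhdsLT_basis_Ico (1 : ℝ)).eventually_iff.mp h
  refine ⟨max a b₀, le_max_left _ _, max_lt ha hb₀, fun s hs => hb ⟨?_, hs.2⟩⟩
  exact le_trans (le_max_right _ _) hs.1

/-- Terminal intervals `[b, 1)` are left-neighbourhoods of `1`. [folklore] -/
theorem Ico_mem_nhdsLT_one {b : ℝ} (hb : b < 1) : Ico b 1 ∈ 𝓝[<] (1 : ℝ) :=
  (nhdsLT_basis_Ico (1 : ℝ)).mem_of_mem hb

end Geometry

/-! ### The branch `(z - ζ)^{1/k}` on the disc slit along the outward ray at `ζ` -/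

section Root

variable {c ζ : ℂ} {k : ℕ}

/-- The standard branch `τ_k(z) = (c - ζ)^{1/k} · ((ζ - z)/(ζ - c))^{1/k}` (principal powers) is
holomorphic wherever `(ζ - z)/(ζ - c)` is in the slit plane. [folklore] -/
theorem differentiableOn_root (k : ℕ) {ε : ℝ} :
    DifferentiableOn ℂ
      (fun z => exp (log (c - ζ) / k) * exp (log ((ζ - z) / (ζ - c)) / k))
      {z | z ∈ ball ζ ε ∧ (ζ - z) / (ζ - c) ∈ slitPlane} := by
  intro z hz
  apply DifferentiableAt.differentiableWithinAt
  apply DifferentiableAt.const_mul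
  apply DifferentiableAt.cexp
  apply DifferentiableAt.div_const
  exact ((differentiableAt_const _).sub differentiableAt_id).div_const _ |>.clog hz.2

/-- `τ_k(z)^k = z - ζ` on the slit region (`k ≥ 1`). [folklore] -/
theorem root_pow (hk : 0 < k) (hζc : ζ ≠ c) {z : ℂ} (hz : (ζ - z) / (ζ - c) ∈ slitPlane) :
    (exp (log (c - ζ) / k) * exp (log ((ζ - z) / (ζ - c)) / k)) ^ k = z - ζ := by
  have hk0 : (k : ℂ) ≠ 0 := Nat.cast_ne_zero.mpr hk.ne'
  have hne : (ζ - z) / (ζ - c) ≠ 0 := slitPlane_ne_zero hz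
  rw [mul_pow, ← Complex.exp_nat_mul, ← Complex.exp_nat_mul, mul_div_cancel₀ _ hk0,
    mul_div_cancel₀ _ hk0, Complex.exp_log (sub_ne_zero.mpr hζc.symm), Complex.exp_log hne]
  field_simp [sub_ne_zero.mpr hζc]
  ring

/-- `‖τ_k(z)‖ < ρ` as soon as `‖z - ζ‖ < ρ^k`. [folklore] -/
theorem norm_root_lt (hk : 0 < k) (hζc : ζ ≠ c) {z : ℂ} (hz : (ζ - z) / (ζ - c) ∈ slitPlane)
    {ρ : ℝ} (hρ : 0 < ρ) (hzρ : ‖z - ζ‖ < ρ ^ k) :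
    ‖exp (log (c - ζ) / k) * exp (log ((ζ - z) / (ζ - c)) / k)‖ < ρ := by
  apply lt_of_pow_lt_pow_left₀ k hρ.le
  rwa [← norm_pow, root_pow hk hζc hz]

/-- Along the radius the branch is continuous in the parameter. [folklore] -/
theorem continuousOn_root_radial (hζc : ζ ≠ c) (k : ℕ) {a : ℝ} :
    ContinuousOn (fun s : ℝ => exp (log (c - ζ) / k) *
      exp (log ((ζ - (c + (s : ℂ) * (ζ - c))) / (ζ - c)) / k)) (Ico a 1) := by
  intro s hs
  have hd := differentiableOn_root (c := c) (ζ := ζ) k (ε := 1)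
  have hslit : (ζ - (c + (s : ℂ) * (ζ - c))) / (ζ - c) ∈ slitPlane :=
    radial_div_mem_slitPlane hζc hs.2
  have hcont : ContinuousAt
      (fun z => exp (log (c - ζ) / k) * exp (log ((ζ - z) / (ζ - c)) / k))
      (c + (s : ℂ) * (ζ - c)) := by
    apply ContinuousAt.mul continuousAt_const
    apply ContinuousAt.cexp
    apply ContinuousAt.div_const
    refine ContinuousAt.clog ?_ hslit
    fun_prop
  exact (ContinuousAt.comp (g := fun z => exp (log (c - ζ) / k) * exp (log ((ζ - z) / (ζ - c)) / k))
    (f := fun s : ℝ => c + (s : ℂ) * (ζ - c)) (x := s) hcont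
    (continuous_radial (c := c) (ζ := ζ)).continuousAt).continuousWithinAt

end Root

/-! ### Cluster values along the radius: the trichotomy (exclusion of Hille's "Case 6") -/

section Cluster

/-- Bolzano–Weierstrass for a filter: if `u` is frequently in a compact set `K`, it has a cluster
value in `K`. [folklore] -/
theorem exists_mapClusterPt_of_frequently_mem {α : Type*} {l : Filter α} {u : α → ℂ} {K : Set ℂ}
    (hK : IsCompact K) (h : ∃ᶠ s in l, u s ∈ K) : ∃ A ∈ K, MapClusterPt A l u := by
  set l' : Filter α := l ⊓ 𝓟 (u ⁻¹' K) with hl'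
  have hne : (l').NeBot := by
    rw [hl', inf_principal_neBot_iff]
    intro U hU
    exact (h.and_eventually hU |>.mono fun x hx => ⟨hx.2, hx.1⟩).exists
  haveI : (map u l').NeBot := hne.map u
  have hle : map u l' ≤ 𝓟 K := by
    rw [le_principal_iff, mem_map, hl']
    exact mem_inf_of_right (mem_principal_self _)
  obtain ⟨A, hAK, hA⟩ := hK.exists_clusterPt hle
  exact ⟨A, hAK, hA.mono (map_mono inf_le_left)⟩

/-- **No oscillation without a regular cluster value** (Hille, §12.1, end of the proof of
Thm. 12.1.1): for a continuous path `u` on `[s₀, 1)` and a finite set `F` (the roots of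
`Q(ζ, ·)`), either `u` has a finite limit as `s → 1⁻`, or `‖u‖ → ∞`, or `u` has a cluster value
outside `F`. [cite: Hille1969, §12.1 Thm. 12.1.1 (proof, "w must tend to a definite limit")] -/
theorem radial_trichotomy {u : ℝ → ℂ} {s₀ : ℝ} (hs₀ : s₀ < 1) (hu : ContinuousOn u (Ico s₀ 1))
    {F : Set ℂ} (hF : F.Finite) :
    (∃ A, Tendsto u (𝓝[<] 1) (𝓝 A)) ∨ Tendsto (fun s => ‖u s‖) (𝓝[<] 1) atTop ∨
      ∃ A, A ∉ F ∧ MapClusterPt A (𝓝[<] 1) u := by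
  by_cases hinf : Tendsto (fun s => ‖u s‖) (𝓝[<] 1) atTop
  · exact Or.inr (Or.inl hinf)
  -- a bounded cluster value
  obtain ⟨M, hM⟩ : ∃ M : ℝ, ∃ᶠ s in 𝓝[<] 1, ‖u s‖ ≤ M := by
    rw [Filter.tendsto_atTop] at hinf
    push Not at hinf
    obtain ⟨M, hM⟩ := hinf
    exact ⟨M, hM.mono fun s hs => hs.le⟩
  obtain ⟨A₀, -, hA₀⟩ := exists_mapClusterPt_of_frequently_mem (isCompact_closedBall 0 M)
    (hM.mono fun s hs => mem_closedBall_zero_iff.mpr hs)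
  by_cases hA₀F : A₀ ∈ F
  swap
  · exact Or.inr (Or.inr ⟨A₀, hA₀F, hA₀⟩)
  by_cases hT : Tendsto u (𝓝[<] 1) (𝓝 A₀)
  · exact Or.inl ⟨A₀, hT⟩
  -- `u` does not tend to `A₀`: it is frequently far from `A₀`
  obtain ⟨ε₀, hε₀, hfar⟩ : ∃ ε₀ > 0, ∃ᶠ s in 𝓝[<] 1, ε₀ ≤ dist (u s) A₀ := by
    rw [Metric.tendsto_nhds] at hT
    push Not at hT
    obtain ⟨ε₀, hε₀, h⟩ := hT
    exact ⟨ε₀, hε₀, h⟩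
  -- a radius avoiding the finitely many distances from `A₀` to `F`
  obtain ⟨ρ, hρI, hρF⟩ : ∃ ρ ∈ Ioo 0 ε₀, ρ ∉ (fun f => dist f A₀) '' F :=
    ((Ioo_infinite hε₀).sdiff (hF.image _)).nonempty
  -- `u` crosses the circle of radius `ρ` about `A₀` arbitrarily late
  have hnear : ∃ᶠ s in 𝓝[<] 1, dist (u s) A₀ < ρ :=
    hA₀.frequently (Metric.ball_mem_nhds A₀ hρI.1)
  have hsph : ∃ᶠ s in 𝓝[<] 1, u s ∈ sphere A₀ ρ := by
    rw [(nhdsLT_basis (1 : ℝ)).frequently_iff]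
    intro s₁ hs₁
    set s₁' := max s₁ s₀ with hs₁'
    have hs₁'1 : s₁' < 1 := max_lt hs₁ hs₀
    obtain ⟨sa, ⟨hsa1, hsa2⟩, hsa⟩ :=
      ((nhdsLT_basis (1 : ℝ)).frequently_iff.mp hnear) s₁' hs₁'1
    obtain ⟨sb, ⟨hsb1, hsb2⟩, hsb⟩ :=
      ((nhdsLT_basis (1 : ℝ)).frequently_iff.mp hfar) sa hsa2
    have hcont : ContinuousOn (fun s => dist (u s) A₀) (Icc sa sb) := by
      refine (continuous_id.dist continuous_const).comp_continuousOn
        (hu.mono fun s hs => ⟨?_, lt_of_le_of_lt hs.2 hsb2⟩)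
      exact le_trans (le_max_right s₁ s₀) (hsa1.le.trans hs.1)
    obtain ⟨s, hs, hsρ⟩ := intermediate_value_Icc hsb1.le hcont
      ⟨hsa.le, hρI.2.le.trans hsb⟩
    refine ⟨s, ⟨lt_of_le_of_lt (le_max_left s₁ s₀) (lt_of_lt_of_le hsa1 hs.1),
      lt_of_le_of_lt hs.2 hsb2⟩, ?_⟩
    exact hsρ
  obtain ⟨A₁, hA₁S, hA₁⟩ := exists_mapClusterPt_of_frequently_mem (isCompact_sphere A₀ ρ) hsph
  refine Or.inr (Or.inr ⟨A₁, fun hA₁F => hρF ⟨A₁, hA₁F, ?_⟩, hA₁⟩)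
  exact hA₁S

end Cluster

/-! ### Local uniqueness with a `C¹` right-hand side -/

section UniqueCD

variable {F : ℂ → ℂ → ℂ} {zs : ℂ}

/-- Local uniqueness for `y' = F(z, y)` with `F` of class `C¹` (over `ℂ`) at `(z*, y₁ z*)`:
two solutions near `z*` with the same value at `z*` agree near `z*`.
[cite: Hille1969, Thm. 2.5.1 (uniqueness)] -/
theorem eventuallyEq_of_hasDerivAt_of_contDiffAt {y₁ y₂ : ℂ → ℂ}
    (hF : ContDiffAt ℂ 1 (fun p : ℂ × ℂ => F p.1 p.2) (zs, y₁ zs))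
    (h₁ : ∀ᶠ z in 𝓝 zs, HasDerivAt y₁ (F z (y₁ z)) z)
    (h₂ : ∀ᶠ z in 𝓝 zs, HasDerivAt y₂ (F z (y₂ z)) z) (heq : y₁ zs = y₂ zs) :
    y₁ =ᶠ[𝓝 zs] y₂ := by
  obtain ⟨K, t, ht, hK⟩ := hF.exists_lipschitzOnWith
  obtain ⟨a, ha, hball⟩ := Metric.mem_nhds_iff.mp ht
  have hL : ∀ z ∈ ball zs a, ∀ y ∈ ball (y₁ zs) a, ∀ y' ∈ ball (y₁ zs) a,
      ‖F z y - F z y'‖ ≤ K * ‖y - y'‖ := by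
    intro z hz y hy y' hy'
    have hzy : (z, y) ∈ t := hball (by rw [← ball_prod_same]; exact ⟨hz, hy⟩)
    have hzy' : (z, y') ∈ t := hball (by rw [← ball_prod_same]; exact ⟨hz, hy'⟩)
    have h := hK.dist_le_mul (z, y) hzy (z, y') hzy'
    rw [dist_eq_norm, dist_eq_norm] at h
    simpa [Prod.norm_def] using h
  exact eventuallyEq_of_hasDerivAt hL (mem_ball_self ha) (mem_ball_self ha) h₁ h₂ heq

end UniqueCD

/-! ### Hille's "Case 1": a regular cluster value forces holomorphy at `ζ` -/

section Regular

variable {N D : ℂ → ℂ → ℂ}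

/-- `N/D` is `C¹` over `ℂ` (indeed analytic) where `D ≠ 0`. [folklore] -/
theorem contDiffAt_div_of_analytic (hN : AnalyticOnNhd ℂ (fun p : ℂ × ℂ => N p.1 p.2) univ)
    (hD : AnalyticOnNhd ℂ (fun p : ℂ × ℂ => D p.1 p.2) univ) {p : ℂ × ℂ} (hp : D p.1 p.2 ≠ 0) :
    ContDiffAt ℂ 1 (fun q : ℂ × ℂ => N q.1 q.2 / D q.1 q.2) p :=
  ((hN p trivial).div (hD p trivial) hp).contDiffAt

/-- A holomorphic solution of `D(z, y) y' = N(z, y)` solves `y' = N/D` near every point where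
`D(z, y(z)) ≠ 0`. [folklore] -/
theorem eventually_hasDerivAt_div {U : Set ℂ} (hU : IsOpen U) {y : ℂ → ℂ}
    (hy : DifferentiableOn ℂ y U) (hode : ∀ z ∈ U, D z (y z) * deriv y z = N z (y z))
    (hDc : Continuous fun p : ℂ × ℂ => D p.1 p.2) {zs : ℂ} (hzs : zs ∈ U)
    (hD0 : D zs (y zs) ≠ 0) :
    ∀ᶠ z in 𝓝 zs, HasDerivAt y (N z (y z) / D z (y z)) z := by
  have hyc : ContinuousAt y zs := (hy.differentiableAt (hU.mem_nhds hzs)).continuousAt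
  have h1 : ∀ᶠ z in 𝓝 zs, D z (y z) ≠ 0 := by
    have hc : ContinuousAt (fun z => D z (y z)) zs :=
      (hDc.continuousAt (x := (zs, y zs))).comp (f := fun z => (z, y z))
        (continuousAt_id.prodMk hyc)
    exact hc.eventually_ne hD0
  filter_upwards [hU.mem_nhds hzs, h1] with z hz hDz
  have hd : HasDerivAt y (deriv y z) z := (hy.differentiableAt (hU.mem_nhds hz)).hasDerivAt
  refine hd.congr_deriv ((eq_div_iff hDz).mpr ?_)
  rw [mul_comm]
  exact hode z hz

/-- **"Case 1" (Theorem of Painlevé)**: if along the radius ending at `ζ` the solution `y` of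
`D y' = N` has a cluster value `A` with `D(ζ, A) ≠ 0`, then `y` coincides, on a terminal piece
of the radius, with a function `Y` holomorphic on a full disc about `ζ` (the solution through a
late point of the radius, whose radius of holomorphy is uniform, Hille (12.1.3), (12.1.16)).
[cite: Hille1969, §12.1, Case 1 and (12.1.16)] -/
theorem extension_of_regular_clusterPt
    (hN : AnalyticOnNhd ℂ (fun p : ℂ × ℂ => N p.1 p.2) univ)
    (hD : AnalyticOnNhd ℂ (fun p : ℂ × ℂ => D p.1 p.2) univ)
    {U : Set ℂ} (hU : IsOpen U) {y : ℂ → ℂ} (hy : DifferentiableOn ℂ y U)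
    (hode : ∀ z ∈ U, D z (y z) * deriv y z = N z (y z))
    {c ζ : ℂ} {r : ℝ} (hζ : ‖ζ - c‖ = r) (hr : 0 < r) {s₀ : ℝ} (hs₀ : s₀ < 1)
    (hpath : ∀ s ∈ Ico s₀ 1, c + (s : ℂ) * (ζ - c) ∈ U)
    {A : ℂ} (hDA : D ζ A ≠ 0)
    (hA : MapClusterPt A (𝓝[<] 1) fun s : ℝ => y (c + (s : ℂ) * (ζ - c))) :
    ∃ δ > 0, ∃ Y : ℂ → ℂ, DifferentiableOn ℂ Y (ball ζ δ) ∧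
      ∃ s₁, s₀ ≤ s₁ ∧ s₁ < 1 ∧
        ∀ s ∈ Ico s₁ 1, y (c + (s : ℂ) * (ζ - c)) = Y (c + (s : ℂ) * (ζ - c)) := by
  have hζc : ζ ≠ c := by
    rintro rfl
    rw [sub_self, norm_zero] at hζ
    exact hr.ne' hζ.symm
  set F : ℂ → ℂ → ℂ := fun z u => N z u / D z u with hF
  have hDc : Continuous fun p : ℂ × ℂ => D p.1 p.2 := hD.continuous
  -- `D ≠ 0` on a product neighbourhood of `(ζ, A)`
  obtain ⟨ε₁, hε₁, hDne⟩ : ∃ ε₁ > 0, ∀ z ∈ ball ζ ε₁, ∀ u ∈ ball A ε₁, D z u ≠ 0 := by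
    have h := (hDc.continuousAt (x := (ζ, A))).eventually_ne hDA
    obtain ⟨ε₁, hε₁, h⟩ := Metric.eventually_nhds_iff_ball.mp h
    refine ⟨ε₁, hε₁, fun z hz u hu => h (z, u) ?_⟩
    rw [← ball_prod_same]
    exact ⟨hz, hu⟩
  have hFcd : ContDiffAt ℂ 1 (fun p : ℂ × ℂ => F p.1 p.2) (ζ, A) :=
    contDiffAt_div_of_analytic hN hD hDA
  obtain ⟨ρ, hρ, η, hη, hρε, hsol⟩ := exists_solution_nhds hFcd hε₁
  -- a late point of the radius, close to `ζ`, where `y` is close to `A`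
  set θ := min (min η (ε₁ / 2)) (ρ / 2) with hθ
  have hθ0 : 0 < θ := by positivity
  have hθη : θ ≤ η := (min_le_left _ _).trans (min_le_left _ _)
  have hθε : θ ≤ ε₁ / 2 := (min_le_left _ _).trans (min_le_right _ _)
  have hθρ : θ ≤ ρ / 2 := min_le_right _ _
  have hev1 : ∀ᶠ s in 𝓝[<] (1 : ℝ), s ∈ Ico s₀ 1 := Ico_mem_nhdsLT_one hs₀
  have hev2 : ∀ᶠ s : ℝ in 𝓝[<] 1, dist (c + (s : ℂ) * (ζ - c)) ζ < θ :=
    (tendsto_radial (c := c) (ζ := ζ)).eventually_mem (Metric.ball_mem_nhds ζ hθ0)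
  have hev : ∀ᶠ s : ℝ in 𝓝[<] 1, s ∈ Ico s₀ 1 ∧ dist (c + (s : ℂ) * (ζ - c)) ζ < θ :=
    hev1.and hev2
  have hfr : ∃ᶠ s : ℝ in 𝓝[<] 1, dist (y (c + (s : ℂ) * (ζ - c))) A < θ :=
    hA.frequently (Metric.ball_mem_nhds A hθ0)
  obtain ⟨sA, hsAA, hsAIco, hsAζ⟩ := (hfr.and_eventually hev).exists
  set zs : ℂ := c + (sA : ℂ) * (ζ - c) with hzs_def
  set ys : ℂ := y zs with hys_def
  have hzsη : zs ∈ ball ζ η := lt_of_lt_of_le hsAζ hθη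
  have hysη : ys ∈ ball A η := lt_of_lt_of_le hsAA hθη
  obtain ⟨Y, hYd, hY0, -, hYder⟩ := hsol zs hzsη ys hysη
  -- local uniqueness at `zs`
  have hzsU : zs ∈ U := hpath _ hsAIco
  have hDzs : D zs ys ≠ 0 :=
    hDne zs (lt_of_lt_of_le hsAζ (hθε.trans (by linarith))) ys
      (lt_of_lt_of_le hsAA (hθε.trans (by linarith)))
  have h₁ : ∀ᶠ z in 𝓝 zs, HasDerivAt y (F z (y z)) z :=
    eventually_hasDerivAt_div hU hy hode hDc hzsU hDzs
  have h₂ : ∀ᶠ z in 𝓝 zs, HasDerivAt Y (F z (Y z)) z := by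
    filter_upwards [isOpen_ball.mem_nhds (mem_ball_self hρ)] with z hz using hYder z hz
  have hFzs : ContDiffAt ℂ 1 (fun p : ℂ × ℂ => F p.1 p.2) (zs, y zs) :=
    contDiffAt_div_of_analytic hN hD hDzs
  have hloc : y =ᶠ[𝓝 zs] Y := eventuallyEq_of_hasDerivAt_of_contDiffAt hFzs h₁ h₂ hY0.symm
  -- identity theorem on the component of `zs` in `U ∩ ball zs ρ`
  set W := connectedComponentIn (U ∩ ball zs ρ) zs with hW
  have hWsub : W ⊆ U ∩ ball zs ρ := connectedComponentIn_subset _ _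
  have hzsW : zs ∈ W := mem_connectedComponentIn ⟨hzsU, mem_ball_self hρ⟩
  have hyW : AnalyticOnNhd ℂ y W := (hy.analyticOnNhd hU).mono fun z hz => (hWsub hz).1
  have hYW : AnalyticOnNhd ℂ Y W := (hYd.analyticOnNhd isOpen_ball).mono fun z hz => (hWsub hz).2
  have hEq : EqOn y Y W :=
    hyW.eqOn_of_preconnected_of_eventuallyEq hYW isPreconnected_connectedComponentIn hzsW hloc
  -- the terminal piece of the radius lies in `W`
  have hdist_zs : dist zs ζ = (1 - sA) * r := by
    rw [dist_eq_norm, ← norm_neg, neg_sub, hzs_def, norm_zeta_sub_radial hζ hsAIco.2.le]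
  have hseg : ∀ s ∈ Ico sA 1, c + (s : ℂ) * (ζ - c) ∈ W := by
    set T := (fun s : ℝ => c + (s : ℂ) * (ζ - c)) '' Ico sA 1 with hT
    have hTpre : IsPreconnected T := isPreconnected_Ico.image _ continuous_radial.continuousOn
    have hzsT : zs ∈ T := ⟨sA, ⟨le_rfl, hsAIco.2⟩, rfl⟩
    have hTsub : T ⊆ U ∩ ball zs ρ := by
      rintro _ ⟨s, hs, rfl⟩
      refine ⟨hpath s ⟨hsAIco.1.trans hs.1, hs.2⟩, ?_⟩
      rw [mem_ball, dist_eq_norm, hzs_def]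
      have heq : c + (s : ℂ) * (ζ - c) - (c + (sA : ℂ) * (ζ - c)) = ((s - sA : ℝ) : ℂ) * (ζ - c) := by
        push_cast
        ring
      rw [heq, norm_mul, Complex.norm_real, Real.norm_eq_abs, abs_of_nonneg (by linarith [hs.1]), hζ]
      have h1 : (s - sA) * r < (1 - sA) * r := by
        apply mul_lt_mul_of_pos_right _ hr
        linarith [hs.2]
      have h2 : (1 - sA) * r < θ := by rw [← hdist_zs]; exact hsAζ
      linarith [hθρ]
    exact fun s hs => (hTpre.subset_connectedComponentIn hzsT hTsub) ⟨s, hs, rfl⟩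
  refine ⟨ρ / 2, by positivity, Y, hYd.mono ?_, sA, hsAIco.1, hsAIco.2,
    fun s hs => hEq (hseg s hs)⟩
  intro z hz
  rw [mem_ball] at hz ⊢
  calc dist z zs ≤ dist z ζ + dist ζ zs := dist_triangle _ _ _
    _ < ρ / 2 + θ := by rw [dist_comm ζ zs]; exact add_lt_add hz hsAζ
    _ ≤ ρ / 2 + ρ / 2 := by gcongr
    _ = ρ := by ring

end Regular

/-! ### Hille's "Case 2": the reciprocal equation and the Puiseux branch -/

section Branch

/-- A `k`-th root of a function analytic and nonzero at a point. [folklore] -/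
theorem exists_kth_root_analytic {g : ℂ → ℂ} {A : ℂ} (hg : AnalyticAt ℂ g A) (hgA : g A ≠ 0)
    {k : ℕ} (hk : 0 < k) :
    ∃ ψ : ℂ → ℂ, AnalyticAt ℂ ψ A ∧ ψ A ≠ 0 ∧ ∀ᶠ u in 𝓝 A, ψ u ^ k = g u := by
  have hk0 : (k : ℂ) ≠ 0 := Nat.cast_ne_zero.mpr hk.ne'
  have h1 : g A / g A = 1 := div_self hgA
  refine ⟨fun u => exp (log (g A) / k) * exp (log (g u / g A) / k), ?_, ?_, ?_⟩
  · apply analyticAt_const.mul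
    apply AnalyticAt.cexp
    apply AnalyticAt.div _ analyticAt_const hk0
    refine (hg.div analyticAt_const hgA).clog ?_
    change g A / g A ∈ slitPlane
    rw [h1]
    exact one_mem_slitPlane
  · simp [h1, exp_ne_zero]
  · have hcont : ContinuousAt (fun u => g u / g A) A := hg.continuousAt.div_const _
    have h2 : ∀ᶠ u in 𝓝 A, g u / g A ≠ 0 := hcont.eventually_ne (by rw [h1]; exact one_ne_zero)
    filter_upwards [h2] with u hu
    rw [mul_pow, ← Complex.exp_nat_mul, ← Complex.exp_nat_mul, mul_div_cancel₀ _ hk0,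
      mul_div_cancel₀ _ hk0, Complex.exp_log hgA, Complex.exp_log hu, mul_div_cancel₀ _ hgA]

/-- A holomorphic local inverse: for `T` analytic at `A` with `T'(A) ≠ 0` there is `H`
holomorphic on a disc about `T A` with `T ∘ H = id` there and `H ∘ T = id` near `A`. [folklore] -/
theorem exists_local_inverse {T : ℂ → ℂ} {A : ℂ} (hT : AnalyticAt ℂ T A) (hT' : deriv T A ≠ 0) :
    ∃ ρ > 0, ∃ H : ℂ → ℂ, DifferentiableOn ℂ H (ball (T A) ρ) ∧ H (T A) = A ∧
      (∀ t ∈ ball (T A) ρ, T (H t) = t) ∧ ∀ᶠ u in 𝓝 A, H (T u) = u := by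
  set H := hT.hasStrictDerivAt.localInverse T (deriv T A) A hT' with hH
  have hHan : AnalyticAt ℂ H (T A) := hT.analyticAt_localInverse hT'
  have hright : ∀ᶠ t in 𝓝 (T A), T (H t) = t := HasStrictDerivAt.eventually_right_inverse ..
  have hleft : ∀ᶠ u in 𝓝 A, H (T u) = u := HasStrictDerivAt.eventually_left_inverse ..
  have hHA : H (T A) = A := HasStrictFDerivAt.localInverse_apply_image ..
  obtain ⟨ρ, hρ, hball⟩ := Metric.eventually_nhds_iff_ball.mp (hHan.eventually_analyticAt.and hright)
  exact ⟨ρ, hρ, H, fun t ht => (hball t ht).1.differentiableAt.differentiableWithinAt, hHA,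
    fun t ht => (hball t ht).2, hleft⟩

/-- A continuous function on `[a, 1)` with values in the `k`-th roots of unity is constant.
[folklore] -/
theorem rootOfUnity_constant {q : ℝ → ℂ} {a : ℝ} {k : ℕ} (hk : 0 < k)
    (hq : ContinuousOn q (Ico a 1)) (hpow : ∀ s ∈ Ico a 1, q s ^ k = 1) :
    ∀ s ∈ Ico a 1, q s = q a := by
  intro s hs
  have hfin : {ω : ℂ | ω ^ k = 1}.Finite := by
    have hne : (Polynomial.X ^ k - Polynomial.C 1 : Polynomial ℂ) ≠ 0 :=
      Polynomial.X_pow_sub_C_ne_zero hk 1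
    refine (Polynomial.finite_setOf_isRoot hne).subset fun ω hω => ?_
    simp only [Set.mem_setOf_eq] at hω ⊢
    simp [Polynomial.IsRoot, hω]
  exact isPreconnected_Ico.constant_of_mapsTo hfin.isDiscrete hq (fun s hs => hpow s hs) hs
    ⟨le_rfl, lt_of_le_of_lt hs.1 hs.2⟩

variable {N D : ℂ → ℂ → ℂ}

/-- **"Case 2" (Hille (12.1.6)–(12.1.8)): the algebraic branch point.** Let `y` solve
`D(z, y) y' = N(z, y)` on an open set containing a terminal piece of the radius ending at `ζ`,
and suppose `y → A` along the radius with `N(ζ, A) ≠ 0`. Integrating the reciprocal equation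
`dz/dy = D/N` through a late point of the radius gives `Z` holomorphic near `A` with
`Z(y(z)) = z` along the radius and `Z(A) = ζ`; writing `Z(u) - ζ = ((u - A) ψ(u))^k` and
inverting `t = (u - A) ψ(u)`, one gets `y = H(ω τ_k)` along the radius for a holomorphic `H`
with `H(0) = A`, a `k`-th root of unity `ω` (absorbed into `H`) and any continuous branch `τ_k`
of `(z - ζ)^{1/k}` along the radius. [cite: Hille1969, §12.1, Case 2, (12.1.6)–(12.1.8)] -/
theorem branch_representation
    (hN : AnalyticOnNhd ℂ (fun p : ℂ × ℂ => N p.1 p.2) univ)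
    (hD : AnalyticOnNhd ℂ (fun p : ℂ × ℂ => D p.1 p.2) univ)
    {U : Set ℂ} (hU : IsOpen U) {y : ℂ → ℂ} (hy : DifferentiableOn ℂ y U)
    (hode : ∀ z ∈ U, D z (y z) * deriv y z = N z (y z))
    {c ζ : ℂ} {r : ℝ} (hζ : ‖ζ - c‖ = r) (hr : 0 < r) {s₀ : ℝ} (hs₀ : s₀ < 1)
    (hpath : ∀ s ∈ Ico s₀ 1, c + (s : ℂ) * (ζ - c) ∈ U)
    {A : ℂ} (hNA : N ζ A ≠ 0)
    (hA : Tendsto (fun s : ℝ => y (c + (s : ℂ) * (ζ - c))) (𝓝[<] 1) (𝓝 A))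
    (τ : ℕ → ℂ → ℂ)
    (hτpow : ∀ k, 0 < k → ∀ s ∈ Ico s₀ 1,
      τ k (c + (s : ℂ) * (ζ - c)) ^ k = c + (s : ℂ) * (ζ - c) - ζ)
    (hτcont : ∀ k, 0 < k → ContinuousOn (fun s : ℝ => τ k (c + (s : ℂ) * (ζ - c))) (Ico s₀ 1)) :
    ∃ k, 0 < k ∧ ∃ ρ > 0, ∃ H : ℂ → ℂ, DifferentiableOn ℂ H (ball 0 ρ) ∧ H 0 = A ∧
      (∀ t ∈ ball 0 ρ, H t = A → t = 0) ∧
      ∃ s₁, s₀ ≤ s₁ ∧ s₁ < 1 ∧ ∀ s ∈ Ico s₁ 1, τ k (c + (s : ℂ) * (ζ - c)) ∈ ball 0 ρ ∧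
        y (c + (s : ℂ) * (ζ - c)) = H (τ k (c + (s : ℂ) * (ζ - c))) := by
  have hζc : ζ ≠ c := by
    rintro rfl
    rw [sub_self, norm_zero] at hζ
    exact hr.ne' hζ.symm
  -- notation for the radius
  set γ : ℝ → ℂ := fun s => c + (s : ℂ) * (ζ - c) with hγ
  have hγζ : ∀ s : ℝ, s ≠ 1 → γ s ≠ ζ := fun s hs => radial_ne_zeta hζc hs
  have hNc : Continuous fun p : ℂ × ℂ => N p.1 p.2 := hN.continuous
  have hDc : Continuous fun p : ℂ × ℂ => D p.1 p.2 := hD.continuous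
  -- analyticity of the swapped functions `(u, x) ↦ N x u`, `(u, x) ↦ D x u`
  have hN' : ∀ q : ℂ × ℂ, AnalyticAt ℂ (fun p : ℂ × ℂ => N p.2 p.1) q := fun q =>
    (hN (q.2, q.1) trivial).comp₂ analyticAt_snd analyticAt_fst
  have hD' : ∀ q : ℂ × ℂ, AnalyticAt ℂ (fun p : ℂ × ℂ => D p.2 p.1) q := fun q =>
    (hD (q.2, q.1) trivial).comp₂ analyticAt_snd analyticAt_fst
  -- the reciprocal equation `dx/du = G(u, x) = D(x, u)/N(x, u)`
  set G : ℂ → ℂ → ℂ := fun u x => D x u / N x u with hG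
  -- `N ≠ 0` on a product neighbourhood of `(ζ, A)`
  obtain ⟨ε₁, hε₁, hNne⟩ : ∃ ε₁ > 0, ∀ z ∈ ball ζ ε₁, ∀ u ∈ ball A ε₁, N z u ≠ 0 := by
    have h := (hNc.continuousAt (x := (ζ, A))).eventually_ne hNA
    obtain ⟨ε₁, hε₁, h⟩ := Metric.eventually_nhds_iff_ball.mp h
    refine ⟨ε₁, hε₁, fun z hz u hu => h (z, u) ?_⟩
    rw [← ball_prod_same]
    exact ⟨hz, hu⟩
  have hGcd : ContDiffAt ℂ 1 (fun p : ℂ × ℂ => G p.1 p.2) (A, ζ) :=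
    ((hD' (A, ζ)).div (hN' (A, ζ)) hNA).contDiffAt
  obtain ⟨ρ₁, hρ₁, η₁, hη₁, hρε, hsol⟩ := exists_solution_nhds hGcd hε₁
  -- a late point of the radius
  set θ := min (min η₁ (ε₁ / 2)) (ρ₁ / 2) with hθ
  have hθ0 : 0 < θ := by positivity
  have hθη : θ ≤ η₁ := (min_le_left _ _).trans (min_le_left _ _)
  have hθε : θ ≤ ε₁ / 2 := (min_le_left _ _).trans (min_le_right _ _)
  have hθρ : θ ≤ ρ₁ / 2 := min_le_right _ _
  have hev : ∀ᶠ s : ℝ in 𝓝[<] 1, dist (y (γ s)) A < θ ∧ dist (γ s) ζ < θ :=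
    (hA.eventually_mem (Metric.ball_mem_nhds A hθ0)).and
      ((tendsto_radial (c := c) (ζ := ζ)).eventually_mem (Metric.ball_mem_nhds ζ hθ0))
  obtain ⟨sA, hs₀A, hsA1, hsA⟩ := exists_Ico_of_eventually_nhdsLT hev hs₀
  set us : ℂ := y (γ sA) with hus
  set xs : ℂ := γ sA with hxs
  have husη : us ∈ ball A η₁ := lt_of_lt_of_le (hsA sA ⟨le_rfl, hsA1⟩).1 hθη
  have hxsη : xs ∈ ball ζ η₁ := lt_of_lt_of_le (hsA sA ⟨le_rfl, hsA1⟩).2 hθη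
  obtain ⟨Z, hZd, hZ0, hZval, hZder⟩ := hsol us husη xs hxsη
  -- along the terminal piece of the radius, `y` stays in `ball us ρ₁` and `ball A ε₁`
  have hyball : ∀ s ∈ Ico sA 1, y (γ s) ∈ ball us ρ₁ := by
    intro s hs
    rw [mem_ball]
    calc dist (y (γ s)) us ≤ dist (y (γ s)) A + dist A us := dist_triangle _ _ _
      _ < θ + θ := by
          rw [dist_comm A us]
          exact add_lt_add (hsA s hs).1 (hsA sA ⟨le_rfl, hsA1⟩).1
      _ ≤ ρ₁ / 2 + ρ₁ / 2 := add_le_add hθρ hθρ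
      _ = ρ₁ := by ring
  have hyA : ∀ s ∈ Ico sA 1, y (γ s) ∈ ball A ε₁ := fun s hs =>
    lt_of_lt_of_le (hsA s hs).1 (hθε.trans (by linarith))
  have hγε : ∀ s ∈ Ico sA 1, γ s ∈ ball ζ ε₁ := fun s hs =>
    lt_of_lt_of_le (hsA s hs).2 (hθε.trans (by linarith))
  -- the open set where the comparison takes place
  set U'' : Set ℂ := (U ∩ y ⁻¹' (ball us ρ₁ ∩ ball A ε₁)) ∩ ball ζ ε₁ with hU''
  have hU''open : IsOpen U'' :=
    (hy.continuousOn.isOpen_inter_preimage hU (isOpen_ball.inter isOpen_ball)).inter isOpen_ball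
  have hU''U : U'' ⊆ U := fun z hz => hz.1.1
  have hpathU'' : ∀ s ∈ Ico sA 1, γ s ∈ U'' := fun s hs =>
    ⟨⟨hpath s ⟨hs₀A.trans hs.1, hs.2⟩, hyball s hs, hyA s hs⟩, hγε s hs⟩
  have hN_U'' : ∀ z ∈ U'', N z (y z) ≠ 0 := fun z hz => hNne z hz.2 (y z) hz.1.2.2
  have hD_U'' : ∀ z ∈ U'', D z (y z) ≠ 0 := by
    intro z hz hDz
    apply hN_U'' z hz
    rw [← hode z (hU''U hz), hDz, zero_mul]
  have hderiv_y : ∀ z ∈ U'', HasDerivAt y (N z (y z) / D z (y z)) z := by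
    intro z hz
    have hd : HasDerivAt y (deriv y z) z := (hy.differentiableAt (hU.mem_nhds (hU''U hz))).hasDerivAt
    refine hd.congr_deriv ((eq_div_iff (hD_U'' z hz)).mpr ?_)
    rw [mul_comm]
    exact hode z (hU''U hz)
  -- `u := Z ∘ y` and `id` both solve `X' = Φ(z, X)` on `U''`, with the same value at `xs`
  set Φ : ℂ → ℂ → ℂ := fun z X => G (y z) X * (N z (y z) / D z (y z)) with hΦ
  have hxsU'' : xs ∈ U'' := hpathU'' sA ⟨le_rfl, hsA1⟩
  have h₁ : ∀ᶠ z in 𝓝 xs, HasDerivAt (fun z => Z (y z)) (Φ z (Z (y z))) z := by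
    filter_upwards [hU''open.mem_nhds hxsU''] with z hz
    have hZ' : HasDerivAt Z (G (y z) (Z (y z))) (y z) := hZder (y z) hz.1.2.1
    exact HasDerivAt.comp z hZ' (hderiv_y z hz)
  have h₂ : ∀ᶠ z in 𝓝 xs, HasDerivAt (fun z : ℂ => z) (Φ z z) z := by
    filter_upwards [hU''open.mem_nhds hxsU''] with z hz
    have h1 : Φ z z = 1 := by
      simp only [hΦ, hG]
      field_simp [hN_U'' z hz, hD_U'' z hz]
    rw [h1]
    exact hasDerivAt_id z
  have hy_an : AnalyticAt ℂ y xs := hy.analyticAt (hU.mem_nhds (hU''U hxsU''))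
  have hΦcd : ContDiffAt ℂ 1 (fun p : ℂ × ℂ => Φ p.1 p.2) (xs, Z (y xs)) := by
    have hyfst : AnalyticAt ℂ (fun p : ℂ × ℂ => y p.1) (xs, Z (y xs)) :=
      AnalyticAt.comp (f := fun p : ℂ × ℂ => p.1) (x := (xs, Z (y xs))) hy_an analyticAt_fst
    have hDXy : AnalyticAt ℂ (fun p : ℂ × ℂ => D p.2 (y p.1)) (xs, Z (y xs)) :=
      (hD _ trivial).comp₂ analyticAt_snd hyfst
    have hNXy : AnalyticAt ℂ (fun p : ℂ × ℂ => N p.2 (y p.1)) (xs, Z (y xs)) :=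
      (hN _ trivial).comp₂ analyticAt_snd hyfst
    have hNzy : AnalyticAt ℂ (fun p : ℂ × ℂ => N p.1 (y p.1)) (xs, Z (y xs)) :=
      (hN _ trivial).comp₂ analyticAt_fst hyfst
    have hDzy : AnalyticAt ℂ (fun p : ℂ × ℂ => D p.1 (y p.1)) (xs, Z (y xs)) :=
      (hD _ trivial).comp₂ analyticAt_fst hyfst
    have hZy : Z (y xs) = xs := hZ0
    have h1 : N (Z (y xs)) (y xs) ≠ 0 := by rw [hZy]; exact hN_U'' xs hxsU''
    have h2 : D xs (y xs) ≠ 0 := hD_U'' xs hxsU''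
    exact (((hDXy.div hNXy h1).mul (hNzy.div hDzy h2))).contDiffAt
  have hloc : (fun z => Z (y z)) =ᶠ[𝓝 xs] fun z : ℂ => z :=
    eventuallyEq_of_hasDerivAt_of_contDiffAt hΦcd h₁ h₂ hZ0
  -- identity theorem: `Z (y z) = z` on the component of `xs` in `U''`, hence along the radius
  set W := connectedComponentIn U'' xs with hW
  have hWsub : W ⊆ U'' := connectedComponentIn_subset _ _
  have hxsW : xs ∈ W := mem_connectedComponentIn hxsU''
  have hZyW : AnalyticOnNhd ℂ (fun z => Z (y z)) W := by
    have hd : DifferentiableOn ℂ (fun z => Z (y z)) U'' :=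
      hZd.comp (hy.mono hU''U) fun z hz => hz.1.2.1
    exact (hd.analyticOnNhd hU''open).mono hWsub
  have hEq : EqOn (fun z => Z (y z)) (fun z : ℂ => z) W :=
    hZyW.eqOn_of_preconnected_of_eventuallyEq (analyticOnNhd_id) isPreconnected_connectedComponentIn
      hxsW hloc
  have hZy_rad : ∀ s ∈ Ico sA 1, Z (y (γ s)) = γ s := by
    set T := γ '' Ico sA 1 with hT
    have hTpre : IsPreconnected T := isPreconnected_Ico.image _ continuous_radial.continuousOn
    have hxsT : xs ∈ T := ⟨sA, ⟨le_rfl, hsA1⟩, rfl⟩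
    have hTsub : T ⊆ U'' := by
      rintro _ ⟨s, hs, rfl⟩
      exact hpathU'' s hs
    intro s hs
    exact hEq ((hTpre.subset_connectedComponentIn hxsT hTsub) ⟨s, hs, rfl⟩)
  -- `Z A = ζ`
  have hAball : A ∈ ball us ρ₁ := by
    rw [mem_ball, dist_comm]
    exact lt_of_lt_of_le (hsA sA ⟨le_rfl, hsA1⟩).1 (hθρ.trans (by linarith))
  have hZA : Z A = ζ := by
    have hZc : ContinuousAt Z A := (hZd.differentiableAt (isOpen_ball.mem_nhds hAball)).continuousAt
    have h1 : Tendsto (fun s : ℝ => Z (y (γ s))) (𝓝[<] 1) (𝓝 (Z A)) := hZc.tendsto.comp hA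
    have h2 : Tendsto (fun s : ℝ => Z (y (γ s))) (𝓝[<] 1) (𝓝 ζ) := by
      refine (tendsto_radial (c := c) (ζ := ζ)).congr' ?_
      filter_upwards [Ico_mem_nhdsLT_one hsA1] with s hs using (hZy_rad s hs).symm
    exact tendsto_nhds_unique h1 h2
  -- `Z - ζ` is not identically zero near `A`: factor it
  have hZan : AnalyticAt ℂ (fun u => Z u - ζ) A :=
    (hZd.analyticAt (isOpen_ball.mem_nhds hAball)).sub analyticAt_const
  have hZne : ¬ ∀ᶠ u in 𝓝 A, Z u - ζ = 0 := by
    intro h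
    have h1 : ∀ᶠ s : ℝ in 𝓝[<] 1, Z (y (γ s)) - ζ = 0 := hA.eventually h
    obtain ⟨s, hs, hsIco⟩ := (h1.and (Ico_mem_nhdsLT_one hsA1)).exists
    rw [hZy_rad s hsIco, sub_eq_zero] at hs
    exact hγζ s hsIco.2.ne hs
  obtain ⟨k, g, hg_an, hgA, hfac⟩ := (hZan.exists_eventuallyEq_pow_smul_nonzero_iff).mpr hZne
  have hk : 0 < k := by
    rcases Nat.eq_zero_or_pos k with hk0 | hk0
    · exfalso
      have h := hfac.self_of_nhds
      rw [hk0, pow_zero, one_smul, hZA, sub_self] at h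
      exact hgA h.symm
    · exact hk0
  -- `ψ^k = g`, `T u = (u - A) ψ u`, `T^k = Z - ζ` near `A`
  obtain ⟨ψ, hψ_an, hψA, hψpow⟩ := exists_kth_root_analytic hg_an hgA hk
  set T : ℂ → ℂ := fun u => (u - A) * ψ u with hT
  have hT_an : AnalyticAt ℂ T A := (analyticAt_id.sub analyticAt_const).mul hψ_an
  have hTA : T A = 0 := by simp [hT]
  have hT' : deriv T A ≠ 0 := by
    have h : HasDerivAt T (1 * ψ A + (A - A) * deriv ψ A) A :=
      ((hasDerivAt_id A).sub_const A).mul hψ_an.differentiableAt.hasDerivAt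
    rw [h.deriv]
    simpa using hψA
  have hTpow : ∀ᶠ u in 𝓝 A, T u ^ k = Z u - ζ := by
    filter_upwards [hψpow, hfac] with u hu hfu
    rw [hfu, smul_eq_mul, hT]
    dsimp only
    rw [mul_pow, hu]
  obtain ⟨ρ₂, hρ₂, H₀, hH₀d, hH₀A, hright, hleft⟩ := exists_local_inverse hT_an hT'
  rw [hTA] at hH₀d hH₀A hright
  -- along the radius: `T (y γs) = ω τ_k (γ s)` with a constant root of unity `ω`
  have hT_cont : ∀ᶠ u in 𝓝 A, ContinuousAt T u :=
    hT_an.eventually_analyticAt.mono fun u hu => hu.continuousAt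
  have hev2a : ∀ᶠ s : ℝ in 𝓝[<] 1, T (y (γ s)) ^ k = Z (y (γ s)) - ζ ∧
      H₀ (T (y (γ s))) = y (γ s) ∧ ContinuousAt T (y (γ s)) :=
    hA.eventually (hTpow.and (hleft.and hT_cont))
  have hev2b : ∀ᶠ s : ℝ in 𝓝[<] 1, s ∈ Ico sA 1 := Ico_mem_nhdsLT_one hsA1
  have hev2c : ∀ᶠ s : ℝ in 𝓝[<] 1, dist (γ s) ζ < ρ₂ ^ k :=
    (tendsto_radial (c := c) (ζ := ζ)).eventually_mem (Metric.ball_mem_nhds ζ (pow_pos hρ₂ k))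
  have hev2 : ∀ᶠ s : ℝ in 𝓝[<] 1, (T (y (γ s)) ^ k = Z (y (γ s)) - ζ ∧ H₀ (T (y (γ s))) = y (γ s) ∧
      ContinuousAt T (y (γ s))) ∧ s ∈ Ico sA 1 ∧ dist (γ s) ζ < ρ₂ ^ k :=
    hev2a.and (hev2b.and hev2c)
  obtain ⟨s₂, hsA2, hs₂1, hs₂⟩ := exists_Ico_of_eventually_nhdsLT hev2 hsA1
  have hs₀2 : s₀ ≤ s₂ := hs₀A.trans hsA2
  have hτk : ∀ s ∈ Ico s₂ 1, τ k (γ s) ^ k = γ s - ζ := fun s hs =>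
    hτpow k hk s ⟨hs₀2.trans hs.1, hs.2⟩
  have hτne : ∀ s ∈ Ico s₂ 1, τ k (γ s) ≠ 0 := by
    intro s hs h0
    have h := hτk s hs
    rw [h0, zero_pow hk.ne', eq_comm, sub_eq_zero] at h
    exact hγζ s hs.2.ne h
  have hτlt : ∀ s ∈ Ico s₂ 1, ‖τ k (γ s)‖ < ρ₂ := by
    intro s hs
    apply lt_of_pow_lt_pow_left₀ k hρ₂.le
    rw [← norm_pow, hτk s hs, ← dist_eq_norm]
    exact (hs₂ s hs).2.2
  have hTy : ∀ s ∈ Ico s₂ 1, T (y (γ s)) ^ k = γ s - ζ := fun s hs => by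
    rw [(hs₂ s hs).1.1, hZy_rad s (hs₂ s hs).2.1]
  set q : ℝ → ℂ := fun s => T (y (γ s)) / τ k (γ s) with hq
  have hq_cont : ContinuousOn q (Ico s₂ 1) := by
    apply ContinuousOn.div
    · intro s hs
      have hyc : ContinuousAt y (γ s) :=
        (hy.differentiableAt (hU.mem_nhds (hpath s ⟨hs₀2.trans hs.1, hs.2⟩))).continuousAt
      have h := ((hs₂ s hs).1.2.2.comp hyc).comp (continuous_radial (c := c) (ζ := ζ)).continuousAt
      exact h.continuousWithinAt
    · exact (hτcont k hk).mono fun s hs => ⟨hs₀2.trans hs.1, hs.2⟩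
    · exact hτne
  have hq_pow : ∀ s ∈ Ico s₂ 1, q s ^ k = 1 := by
    intro s hs
    rw [hq]
    dsimp only
    rw [div_pow, hTy s hs, hτk s hs, div_self]
    exact sub_ne_zero.mpr (hγζ s hs.2.ne)
  have hq_const : ∀ s ∈ Ico s₂ 1, q s = q s₂ := rootOfUnity_constant hk hq_cont hq_pow
  set ω : ℂ := q s₂ with hω
  have hωk : ω ^ k = 1 := hq_pow s₂ ⟨le_rfl, hs₂1⟩
  have hωnorm : ‖ω‖ = 1 := by
    have h := congr_arg norm hωk
    rw [norm_pow, norm_one] at h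
    exact (pow_eq_one_iff_of_nonneg (norm_nonneg ω) hk.ne').mp h
  have hω0 : ω ≠ 0 := fun h => by simp [h, hk.ne'] at hωk
  have hTω : ∀ s ∈ Ico s₂ 1, T (y (γ s)) = ω * τ k (γ s) := by
    intro s hs
    have h := hq_const s hs
    rw [hq] at h
    dsimp only at h
    rwa [div_eq_iff (hτne s hs)] at h
  -- the function `H t = H₀ (ω t)`
  refine ⟨k, hk, ρ₂, hρ₂, fun t => H₀ (ω * t), ?_, ?_, ?_, s₂, hs₀2, hs₂1, fun s hs => ⟨?_, ?_⟩⟩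
  · refine hH₀d.comp ((differentiableOn_const ω).mul differentiableOn_id) fun t ht => ?_
    simp only [mem_ball, dist_zero_right, norm_mul, hωnorm, one_mul] at ht ⊢
    exact ht
  · simpa using hH₀A
  · intro t ht hHt
    dsimp only at hHt
    have hmem : ω * t ∈ ball (0 : ℂ) ρ₂ := by
      simp only [mem_ball, dist_zero_right, norm_mul, hωnorm, one_mul] at ht ⊢
      exact ht
    have h := hright (ω * t) hmem
    rw [hHt, hTA] at h
    exact (mul_eq_zero.mp h.symm).resolve_left hω0
  · simpa [mem_ball, dist_zero_right] using hτlt s hs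
  · dsimp only
    rw [← hTω s hs]
    exact ((hs₂ s hs).1.2.1).symm

end Branch

/-! ### Zeros of holomorphic functions and the expansion on the lens -/

section Tail

/-- Order of vanishing: a holomorphic `f` on `ball a ρ` with `f a = 0`, not identically zero
near `a`, factors as `f z = (z - a)^n g z` with `n ≥ 1` and `g` holomorphic and zero-free on a
smaller disc. [folklore] -/
theorem exists_factor_zero {f : ℂ → ℂ} {a : ℂ} {ρ : ℝ} (hρ : 0 < ρ)
    (hf : DifferentiableOn ℂ f (ball a ρ)) (hfa : f a = 0) (hne : ¬ ∀ᶠ z in 𝓝 a, f z = 0) :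
    ∃ n, 0 < n ∧ ∃ ρ' > 0, ρ' ≤ ρ ∧ ∃ g : ℂ → ℂ, DifferentiableOn ℂ g (ball a ρ') ∧
      (∀ z ∈ ball a ρ', g z ≠ 0) ∧ ∀ z ∈ ball a ρ', f z = (z - a) ^ n * g z := by
  have hfan : AnalyticAt ℂ f a := hf.analyticAt (isOpen_ball.mem_nhds (mem_ball_self hρ))
  obtain ⟨n, g, hg_an, hga, hfac⟩ := hfan.exists_eventuallyEq_pow_smul_nonzero_iff.mpr hne
  have hn : 0 < n := by
    rcases Nat.eq_zero_or_pos n with h0 | h0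
    · exfalso
      have h := hfac.self_of_nhds
      rw [h0, pow_zero, one_smul, hfa] at h
      exact hga h.symm
    · exact h0
  have hev : ∀ᶠ z in 𝓝 a, AnalyticAt ℂ g z ∧ g z ≠ 0 ∧ f z = (z - a) ^ n • g z :=
    hg_an.eventually_analyticAt.and ((hg_an.continuousAt.eventually_ne hga).and hfac)
  obtain ⟨ρ₀, hρ₀, hball⟩ := Metric.eventually_nhds_iff_ball.mp hev
  refine ⟨n, hn, min ρ₀ ρ, lt_min hρ₀ hρ, min_le_right _ _, g, ?_, ?_, ?_⟩
  · exact fun z hz =>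
      (hball z (ball_subset_ball (min_le_left _ _) hz)).1.differentiableAt.differentiableWithinAt
  · exact fun z hz => (hball z (ball_subset_ball (min_le_left _ _) hz)).2.1
  · intro z hz
    have h := (hball z (ball_subset_ball (min_le_left _ _) hz)).2.2
    rwa [smul_eq_mul] at h

/-- **From the radius to the lens** (the last step of the proof): if along a terminal piece of
the radius `w · τ_k^n = h ∘ τ_k` with `h` holomorphic on `ball 0 ρ` and `τ_k` the standard
branch of `(z - ζ)^{1/k}`, then the same identity holds on the lens `ball c r ∩ ball ζ ε`,
`ε = min(ρ^k, r)`, by the identity theorem (both sides are holomorphic on the lens, which lies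
in the slit disc). [cite: Hille1969, §12.1 Thm. 12.1.1, (12.1.15)] -/
theorem representation_of_tail {c ζ : ℂ} {r : ℝ} (hζ : ‖ζ - c‖ = r) (hr : 0 < r)
    {w : ℂ → ℂ} (hw : DifferentiableOn ℂ w (ball c r))
    {k : ℕ} (hk : 0 < k) (n : ℕ) {ρ : ℝ} (hρ : 0 < ρ) {h : ℂ → ℂ}
    (hh : DifferentiableOn ℂ h (ball 0 ρ)) {s₁ : ℝ} (hs₁ : s₁ < 1)
    (htail : ∀ s ∈ Ico s₁ 1,
      ‖exp (log (c - ζ) / k) * exp (log ((ζ - (c + (s : ℂ) * (ζ - c))) / (ζ - c)) / k)‖ < ρ →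
      w (c + (s : ℂ) * (ζ - c)) *
          (exp (log (c - ζ) / k) * exp (log ((ζ - (c + (s : ℂ) * (ζ - c))) / (ζ - c)) / k)) ^ n =
        h (exp (log (c - ζ) / k) * exp (log ((ζ - (c + (s : ℂ) * (ζ - c))) / (ζ - c)) / k))) :
    ∃ (ν n : ℕ) (ε ρ : ℝ) (τ h : ℂ → ℂ), 0 < ν ∧ 0 < ε ∧ 0 < ρ ∧
      DifferentiableOn ℂ τ {z | z ∈ ball ζ ε ∧ (ζ - z) / (ζ - c) ∈ slitPlane} ∧
      (∀ z ∈ ball ζ ε, (ζ - z) / (ζ - c) ∈ slitPlane →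
        τ z ^ ν = z - ζ ∧ τ z ∈ ball (0 : ℂ) ρ) ∧
      DifferentiableOn ℂ h (ball 0 ρ) ∧
      ∀ z ∈ ball c r ∩ ball ζ ε, w z * τ z ^ n = h (τ z) := by
  have hζc : ζ ≠ c := by
    rintro rfl
    rw [sub_self, norm_zero] at hζ
    exact hr.ne' hζ.symm
  set τ : ℂ → ℂ := fun z => exp (log (c - ζ) / k) * exp (log ((ζ - z) / (ζ - c)) / k) with hτ
  set γ : ℝ → ℂ := fun s => c + (s : ℂ) * (ζ - c) with hγ
  set ε : ℝ := min (ρ ^ k) r with hε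
  have hε0 : 0 < ε := lt_min (pow_pos hρ k) hr
  have hτpow : ∀ z, (ζ - z) / (ζ - c) ∈ slitPlane → τ z ^ k = z - ζ := fun z hz =>
    root_pow hk hζc hz
  have hτlt : ∀ z ∈ ball ζ ε, (ζ - z) / (ζ - c) ∈ slitPlane → ‖τ z‖ < ρ := fun z hz hzs =>
    norm_root_lt hk hζc hzs hρ (lt_of_lt_of_le (mem_ball_iff_norm.mp hz) (min_le_left _ _))
  refine ⟨k, n, ε, ρ, τ, h, hk, hε0, hρ, differentiableOn_root k,
    fun z hz hzs => ⟨hτpow z hzs, ?_⟩, hh, ?_⟩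
  · rw [mem_ball, dist_zero_right]
    exact hτlt z hz hzs
  -- the lens and the two holomorphic functions on it
  set L : Set ℂ := ball c r ∩ ball ζ ε with hL
  have hLslit : ∀ z ∈ L, (ζ - z) / (ζ - c) ∈ slitPlane := fun z hz =>
    div_mem_slitPlane_of_mem_ball hζ hz.1
  have hLopen : IsOpen L := isOpen_ball.inter isOpen_ball
  have hLconn : IsPreconnected L := ((convex_ball c r).inter (convex_ball ζ ε)).isPreconnected
  have hτL : DifferentiableOn ℂ τ L :=
    (differentiableOn_root k (ε := ε)).mono fun z hz => ⟨hz.2, hLslit z hz⟩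
  have hτLρ : MapsTo τ L (ball (0 : ℂ) ρ) := fun z hz => by
    rw [mem_ball, dist_zero_right]
    exact hτlt z hz.2 (hLslit z hz)
  have hf₁ : DifferentiableOn ℂ (fun z => w z * τ z ^ n) L :=
    (hw.mono inter_subset_left).mul (hτL.pow n)
  have hf₂ : DifferentiableOn ℂ (fun z => h (τ z)) L := hh.comp hτL hτLρ
  -- a point of the radius inside the lens
  set s₂ : ℝ := max (max s₁ 0) (1 - ε / (2 * r)) with hs₂
  have hpos : 0 < ε / (2 * r) := by positivity
  have hs₂1 : s₂ < 1 := max_lt (max_lt hs₁ one_pos) (by linarith)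
  have hs₁2 : s₁ ≤ s₂ := (le_max_left _ _).trans (le_max_left _ _)
  have h02 : 0 ≤ s₂ := (le_max_right _ _).trans (le_max_left _ _)
  have hεr : 1 - ε / r < s₂ := by
    have h1 : ε / (2 * r) < ε / r := div_lt_div_of_pos_left hε0 hr (by linarith)
    have h2 : 1 - ε / (2 * r) ≤ s₂ := le_max_right _ _
    linarith
  have hradL : ∀ s ∈ Ico s₂ 1, γ s ∈ L := fun s hs =>
    ⟨radial_mem_ball hζ hr ⟨h02.trans hs.1, hs.2⟩,
      radial_mem_ball_zeta hζ hr hs.2.le (lt_of_lt_of_le hεr hs.1)⟩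
  set z₀ : ℂ := γ s₂ with hz₀
  have hz₀L : z₀ ∈ L := hradL s₂ ⟨le_rfl, hs₂1⟩
  -- the identity holds frequently near `z₀`
  have hfreq : ∃ᶠ z in 𝓝[≠] z₀, w z * τ z ^ n = h (τ z) := by
    have htend : Tendsto γ (𝓝[>] s₂) (𝓝[≠] z₀) := by
      refine tendsto_nhdsWithin_of_tendsto_nhds_of_eventually_within γ
        (((continuous_radial (c := c) (ζ := ζ)).tendsto s₂).mono_left nhdsWithin_le_nhds) ?_
      filter_upwards [self_mem_nhdsWithin] with s hs
      exact fun h0 => (ne_of_gt (mem_Ioi.mp hs)) (radial_injective hζc h0)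
    apply htend.frequently
    have hev : ∀ᶠ s in 𝓝[>] s₂, w (γ s) * τ (γ s) ^ n = h (τ (γ s)) := by
      filter_upwards [Ioo_mem_nhdsGT hs₂1] with s hs
      have hsI : s ∈ Ico s₂ 1 := ⟨hs.1.le, hs.2⟩
      exact htail s ⟨hs₁2.trans hsI.1, hsI.2⟩ (hτlt _ (hradL s hsI).2 (hLslit _ (hradL s hsI)))
    exact hev.frequently
  have hEq := (hf₁.analyticOnNhd hLopen).eqOn_of_preconnected_of_frequently_eq
    (hf₂.analyticOnNhd hLopen) hLconn hz₀L hfreq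
  exact fun z hz => hEq hz

end Tail

/-! ### Assembly -/

section Main

/-- Polynomials in `(z, w)` are analytic functions on `ℂ²`. [folklore] -/
theorem analyticOnNhd_mvPolynomial_eval (R : MvPolynomial (Fin 2) ℂ) :
    AnalyticOnNhd ℂ (fun p : ℂ × ℂ => MvPolynomial.eval ![p.1, p.2] R) univ := by
  intro p _
  have h : ∀ i : Fin 2, AnalyticAt ℂ (fun q : ℂ × ℂ => (![q.1, q.2] : Fin 2 → ℂ) i) p := by
    intro i
    fin_cases i
    · simpa using analyticAt_fst
    · simpa using analyticAt_snd
  have := AnalyticAt.aeval_mvPolynomial (f := fun q : ℂ × ℂ => (![q.1, q.2] : Fin 2 → ℂ)) h R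
  simpa [MvPolynomial.coe_aeval_eq_eval] using this

/-- **Regular point at `ζ`** ("Case 1"): a cluster value `A` with `D(ζ, A) ≠ 0` gives the
conclusion of the theorem with `ν = 1`, `n = 0`. [cite: Hille1969, §12.1 Thm. 12.1.1
(proof, `μ = 0, ν = 1`)] -/
theorem regular_representation {c ζ : ℂ} {r : ℝ} (hζ : ‖ζ - c‖ = r) (hr : 0 < r)
    {w : ℂ → ℂ} (hw : DifferentiableOn ℂ w (ball c r)) {Nf Df : ℂ → ℂ → ℂ}
    (hNan : AnalyticOnNhd ℂ (fun p : ℂ × ℂ => Nf p.1 p.2) univ)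
    (hDan : AnalyticOnNhd ℂ (fun p : ℂ × ℂ => Df p.1 p.2) univ)
    (hode : ∀ z ∈ ball c r, Df z (w z) * deriv w z = Nf z (w z))
    {A : ℂ} (hDA : Df ζ A ≠ 0)
    (hA : MapClusterPt A (𝓝[<] 1) fun s : ℝ => w (c + (s : ℂ) * (ζ - c))) :
    ∃ (ν n : ℕ) (ε ρ : ℝ) (τ h : ℂ → ℂ), 0 < ν ∧ 0 < ε ∧ 0 < ρ ∧
      DifferentiableOn ℂ τ {z | z ∈ ball ζ ε ∧ (ζ - z) / (ζ - c) ∈ slitPlane} ∧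
      (∀ z ∈ ball ζ ε, (ζ - z) / (ζ - c) ∈ slitPlane →
        τ z ^ ν = z - ζ ∧ τ z ∈ ball (0 : ℂ) ρ) ∧
      DifferentiableOn ℂ h (ball 0 ρ) ∧
      ∀ z ∈ ball c r ∩ ball ζ ε, w z * τ z ^ n = h (τ z) := by
  have hζc : ζ ≠ c := by
    rintro rfl
    rw [sub_self, norm_zero] at hζ
    exact hr.ne' hζ.symm
  obtain ⟨δ, hδ, Y, hYd, s₁, -, hs₁, htail⟩ := extension_of_regular_clusterPt hNan hDan
    isOpen_ball hw hode hζ hr zero_lt_one (fun s hs => radial_mem_ball hζ hr hs) hDA hA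
  refine representation_of_tail hζ hr hw one_pos 0 hδ (h := fun t => Y (ζ + t)) ?_ hs₁ ?_
  · refine hYd.comp ((differentiableOn_const ζ).add differentiableOn_id) fun t ht => ?_
    simpa [mem_ball, dist_eq_norm] using ht
  · intro s hs _
    have h1 := root_pow one_pos hζc (radial_div_mem_slitPlane hζc hs.2) (k := 1)
    rw [pow_one] at h1
    rw [pow_zero, mul_one, h1, add_sub_cancel]
    exact htail s hs

/-- **The point at infinity** ("Case 5"): if `‖w‖ → ∞` along the radius, the substitution
`v = 1/w` and the transformed equation `D₁(z, v) v' = N₁(z, v)` at `(ζ, 0)` (regular: a pole,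
`ν = 1`, `n ≥ 1`; or a branch point: an algebraic infinitude, `ν = k`, `n ≥ 1`) give the
conclusion of the theorem. [cite: Hille1969, §12.1, Case 5 and Thm. 12.1.1 (proof)] -/
theorem infinity_representation {P Q N₁ D₁ : MvPolynomial (Fin 2) ℂ} {c ζ : ℂ} {r : ℝ}
    (hζ : ‖ζ - c‖ = r) (hr : 0 < r) {w : ℂ → ℂ} (hw : DifferentiableOn ℂ w (ball c r))
    (hode : ∀ z ∈ ball c r,
      MvPolynomial.eval ![z, w z] Q * deriv w z = MvPolynomial.eval ![z, w z] P)
    (hid : ∀ z w d : ℂ, w ≠ 0 → MvPolynomial.eval ![z, w] Q * d = MvPolynomial.eval ![z, w] P →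
      MvPolynomial.eval ![z, w⁻¹] D₁ * (-d / w ^ 2) = MvPolynomial.eval ![z, w⁻¹] N₁)
    (hND : MvPolynomial.eval ![ζ, 0] N₁ ≠ 0 ∨ MvPolynomial.eval ![ζ, 0] D₁ ≠ 0)
    (hinfty : Tendsto (fun s : ℝ => ‖w (c + (s : ℂ) * (ζ - c))‖) (𝓝[<] 1) atTop) :
    ∃ (ν n : ℕ) (ε ρ : ℝ) (τ h : ℂ → ℂ), 0 < ν ∧ 0 < ε ∧ 0 < ρ ∧
      DifferentiableOn ℂ τ {z | z ∈ ball ζ ε ∧ (ζ - z) / (ζ - c) ∈ slitPlane} ∧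
      (∀ z ∈ ball ζ ε, (ζ - z) / (ζ - c) ∈ slitPlane →
        τ z ^ ν = z - ζ ∧ τ z ∈ ball (0 : ℂ) ρ) ∧
      DifferentiableOn ℂ h (ball 0 ρ) ∧
      ∀ z ∈ ball c r ∩ ball ζ ε, w z * τ z ^ n = h (τ z) := by
  have hζc : ζ ≠ c := by
    rintro rfl
    rw [sub_self, norm_zero] at hζ
    exact hr.ne' hζ.symm
  set Nf : ℂ → ℂ → ℂ := fun z u => MvPolynomial.eval ![z, u] N₁ with hNf
  set Df : ℂ → ℂ → ℂ := fun z u => MvPolynomial.eval ![z, u] D₁ with hDf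
  have hNan : AnalyticOnNhd ℂ (fun p : ℂ × ℂ => Nf p.1 p.2) univ :=
    analyticOnNhd_mvPolynomial_eval N₁
  have hDan : AnalyticOnNhd ℂ (fun p : ℂ × ℂ => Df p.1 p.2) univ :=
    analyticOnNhd_mvPolynomial_eval D₁
  set γ : ℝ → ℂ := fun s => c + (s : ℂ) * (ζ - c) with hγ
  -- the open set where `w ≠ 0` and the reciprocal `v = 1/w`
  set U : Set ℂ := ball c r ∩ w ⁻¹' {0}ᶜ with hU
  have hUopen : IsOpen U := hw.continuousOn.isOpen_inter_preimage isOpen_ball isOpen_compl_singleton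
  set v : ℂ → ℂ := fun z => (w z)⁻¹ with hv
  have hvd : DifferentiableOn ℂ v U := (hw.mono fun z hz => hz.1).inv fun z hz => hz.2
  have hodev : ∀ z ∈ U, Df z (v z) * deriv v z = Nf z (v z) := by
    intro z hz
    have hdw : DifferentiableAt ℂ w z := hw.differentiableAt (isOpen_ball.mem_nhds hz.1)
    rw [hv]
    dsimp only
    rw [deriv_fun_inv'' hdw hz.2]
    exact hid z (w z) (deriv w z) hz.2 (hode z hz.1)
  -- a terminal piece of the radius inside `U`
  have hev : ∀ᶠ s : ℝ in 𝓝[<] 1, 1 ≤ ‖w (γ s)‖ := Filter.tendsto_atTop.mp hinfty 1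
  obtain ⟨s₀, h0s₀, hs₀1, hs₀⟩ := exists_Ico_of_eventually_nhdsLT hev zero_lt_one
  have hwne : ∀ s ∈ Ico s₀ 1, w (γ s) ≠ 0 := by
    intro s hs h0
    have h := hs₀ s hs
    rw [h0, norm_zero] at h
    linarith
  have hpathU : ∀ s ∈ Ico s₀ 1, γ s ∈ U := fun s hs =>
    ⟨radial_mem_ball hζ hr ⟨h0s₀.trans hs.1, hs.2⟩, hwne s hs⟩
  have hv0 : Tendsto (fun s : ℝ => v (γ s)) (𝓝[<] 1) (𝓝 0) := by
    rw [tendsto_zero_iff_norm_tendsto_zero]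
    have h := tendsto_inv_atTop_zero.comp hinfty
    refine h.congr fun s => ?_
    simp [hγ, hv, norm_inv]
  -- the family of branches
  set τ : ℕ → ℂ → ℂ := fun k z => exp (log (c - ζ) / k) * exp (log ((ζ - z) / (ζ - c)) / k)
    with hτ
  have hτpow : ∀ k, 0 < k → ∀ s ∈ Ico s₀ 1, τ k (γ s) ^ k = γ s - ζ := fun k hk s hs =>
    root_pow hk hζc (radial_div_mem_slitPlane hζc hs.2)
  have hτcont : ∀ k, 0 < k → ContinuousOn (fun s : ℝ => τ k (γ s)) (Ico s₀ 1) := fun k _ =>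
    continuousOn_root_radial hζc k
  have hw_eq : ∀ z, w z = (v z)⁻¹ := fun z => by simp [hv]
  by_cases hD0 : Df ζ 0 = 0
  · -- an algebraic infinitude (branch point of `v` at `(ζ, 0)`)
    have hN0 : Nf ζ 0 ≠ 0 := by
      rcases hND with h | h
      · exact h
      · exact absurd hD0 h
    obtain ⟨k, hk, ρ, hρ, H, hHd, hH0, hHinj, s₁, hs₀1', hs₁, htail⟩ :=
      branch_representation hNan hDan hUopen hvd hodev hζ hr hs₀1 hpathU hN0 hv0 τ hτpow hτcont
    have hHne : ¬ ∀ᶠ t in 𝓝 0, H t = 0 := by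
      intro h
      obtain ⟨ρ', hρ', hb⟩ := Metric.eventually_nhds_iff_ball.mp h
      set t : ℂ := ((min ρ' ρ / 2 : ℝ) : ℂ) with ht
      have htpos : 0 < min ρ' ρ / 2 := by positivity
      have ht0 : t ≠ 0 := by
        rw [ht]
        exact_mod_cast htpos.ne'
      have hnorm : ‖t‖ = min ρ' ρ / 2 := by
        rw [ht, Complex.norm_real, Real.norm_eq_abs, abs_of_pos htpos]
      have ht1 : t ∈ ball (0 : ℂ) ρ' := by
        rw [mem_ball, dist_zero_right, hnorm]
        linarith [min_le_left ρ' ρ]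
      have ht2 : t ∈ ball (0 : ℂ) ρ := by
        rw [mem_ball, dist_zero_right, hnorm]
        linarith [min_le_right ρ' ρ]
      exact ht0 (hHinj t ht2 (hb t ht1))
    obtain ⟨n, hn, ρ', hρ', hρ'le, g, hg, hg0, hfac⟩ := exists_factor_zero hρ hHd hH0 hHne
    refine representation_of_tail hζ hr hw hk n hρ' (h := fun t => (g t)⁻¹) (hg.inv hg0) hs₁ ?_
    intro s hs hlt
    have hsI : s ∈ Ico s₀ 1 := ⟨hs₀1'.trans hs.1, hs.2⟩
    have hmem : τ k (γ s) ∈ ball (0 : ℂ) ρ' := by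
      rw [mem_ball, dist_zero_right]
      exact hlt
    have h1 : v (γ s) = τ k (γ s) ^ n * g (τ k (γ s)) := by
      have h := (htail s hs).2
      rw [hfac _ hmem, sub_zero] at h
      exact h
    have hτ0 : τ k (γ s) ≠ 0 := by
      intro h0
      have h := hτpow k hk s hsI
      rw [h0, zero_pow hk.ne', eq_comm, sub_eq_zero] at h
      exact radial_ne_zeta hζc hs.2.ne h
    change w (γ s) * τ k (γ s) ^ n = (g (τ k (γ s)))⁻¹
    rw [hw_eq, h1, mul_inv, mul_comm, ← mul_assoc, mul_inv_cancel₀ (pow_ne_zero n hτ0), one_mul]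
  · -- a pole (`v` holomorphic at `ζ` with a zero of order `n`)
    obtain ⟨δ, hδ, V, hVd, s₁, hs₀1', hs₁, htail⟩ := extension_of_regular_clusterPt hNan hDan
      hUopen hvd hodev hζ hr hs₀1 hpathU hD0 hv0.mapClusterPt
    have hVζ : V ζ = 0 := by
      have hVc : ContinuousAt V ζ :=
        (hVd.differentiableAt (isOpen_ball.mem_nhds (mem_ball_self hδ))).continuousAt
      have h1 : Tendsto (fun s : ℝ => V (γ s)) (𝓝[<] 1) (𝓝 (V ζ)) :=
        hVc.tendsto.comp (tendsto_radial (c := c) (ζ := ζ))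
      have h2 : Tendsto (fun s : ℝ => V (γ s)) (𝓝[<] 1) (𝓝 0) := by
        refine hv0.congr' ?_
        filter_upwards [Ico_mem_nhdsLT_one hs₁] with s hs using htail s hs
      exact tendsto_nhds_unique h1 h2
    have hVne : ¬ ∀ᶠ z in 𝓝 ζ, V z = 0 := by
      intro h
      have h1 : ∀ᶠ s : ℝ in 𝓝[<] 1, V (γ s) = 0 := (tendsto_radial (c := c) (ζ := ζ)).eventually h
      obtain ⟨s, hs0, hsI⟩ := (h1.and (Ico_mem_nhdsLT_one hs₁)).exists
      have h2 := htail s hsI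
      rw [hs0] at h2
      exact (inv_ne_zero (hwne s ⟨hs₀1'.trans hsI.1, hsI.2⟩)) h2
    obtain ⟨n, hn, ρ', hρ', hρ'le, g, hg, hg0, hfac⟩ := exists_factor_zero hδ hVd hVζ hVne
    have hmap : MapsTo (fun t : ℂ => ζ + t) (ball (0 : ℂ) ρ') (ball ζ ρ') := fun t ht => by
      simpa [mem_ball, dist_eq_norm] using ht
    refine representation_of_tail hζ hr hw one_pos n hρ' (h := fun t => (g (ζ + t))⁻¹) ?_ hs₁ ?_
    · exact (hg.comp ((differentiableOn_const ζ).add differentiableOn_id) hmap).inv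
        fun t ht => hg0 _ (hmap ht)
    · intro s hs hlt
      have hsI : s ∈ Ico s₀ 1 := ⟨hs₀1'.trans hs.1, hs.2⟩
      have h1 := root_pow one_pos hζc (radial_div_mem_slitPlane hζc hs.2) (k := 1)
      rw [pow_one] at h1
      rw [h1] at hlt ⊢
      rw [add_sub_cancel]
      have hmem : γ s ∈ ball ζ ρ' := by
        rw [mem_ball, dist_eq_norm]
        exact hlt
      have h2 : v (γ s) = (γ s - ζ) ^ n * g (γ s) := by
        rw [← hfac _ hmem]
        exact htail s hs
      have hne : γ s - ζ ≠ 0 := sub_ne_zero.mpr (radial_ne_zeta hζc hs.2.ne)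
      change w (γ s) * (γ s - ζ) ^ n = (g (γ s))⁻¹
      rw [hw_eq, h2, mul_inv, mul_comm, ← mul_assoc, mul_inv_cancel₀ (pow_ne_zero n hne), one_mul]

/-- **Painlevé's theorem (Hille 1969, Thm. 12.1.1)**: discharge of the named fact
`painleve_firstOrder_firstDegree`. [cite: Hille1969, §12.1 Thm. 12.1.1 and (12.1.15)] -/
theorem painleve_firstOrder_firstDegree_holds : painleve_firstOrder_firstDegree := by
  intro P Q hQ hPQ
  obtain ⟨S, N₁, D₁, hS₁, hS₂, hid, hinf⟩ := fixedSingular_package P Q hQ hPQ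
  refine ⟨(S : Set ℂ), S.finite_toSet, ?_⟩
  intro c r w hw hode ζ hζ hζS
  have hζS' : ζ ∉ S := fun h => hζS (Finset.mem_coe.mpr h)
  rcases le_or_gt r 0 with hr | hr
  · -- degenerate disc (`r = 0`, `ζ = c`): the slit region and the lens are empty
    have hr0 : r = 0 := le_antisymm hr (hζ ▸ norm_nonneg _)
    have hζc : ζ = c := by
      rw [hr0, norm_eq_zero, sub_eq_zero] at hζ
      exact hζ
    refine ⟨1, 0, 1, 1, fun _ => 0, fun _ => 0, one_pos, one_pos, one_pos,
      differentiableOn_const _, ?_, differentiableOn_const _, ?_⟩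
    · intro z _ hzs
      exfalso
      rw [hζc, sub_self, div_zero] at hzs
      exact slitPlane_ne_zero hzs rfl
    · intro z hz
      exfalso
      have h1 : z ∈ ball c r := hz.1
      rw [mem_ball, hr0] at h1
      exact (dist_nonneg.trans_lt h1).false
  -- the disc is non-degenerate
  have hζc : ζ ≠ c := by
    rintro rfl
    rw [sub_self, norm_zero] at hζ
    exact hr.ne' hζ.symm
  set Nf : ℂ → ℂ → ℂ := fun z u => MvPolynomial.eval ![z, u] P with hNf
  set Df : ℂ → ℂ → ℂ := fun z u => MvPolynomial.eval ![z, u] Q with hDf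
  have hNan : AnalyticOnNhd ℂ (fun p : ℂ × ℂ => Nf p.1 p.2) univ :=
    analyticOnNhd_mvPolynomial_eval P
  have hDan : AnalyticOnNhd ℂ (fun p : ℂ × ℂ => Df p.1 p.2) univ :=
    analyticOnNhd_mvPolynomial_eval Q
  have hodeU : ∀ z ∈ ball c r, Df z (w z) * deriv w z = Nf z (w z) := hode
  set γ : ℝ → ℂ := fun s => c + (s : ℂ) * (ζ - c) with hγ
  have hpath : ∀ s ∈ Ico (0 : ℝ) 1, γ s ∈ ball c r := fun s hs => radial_mem_ball hζ hr hs
  have hu : ContinuousOn (fun s : ℝ => w (γ s)) (Ico (0 : ℝ) 1) :=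
    hw.continuousOn.comp continuous_radial.continuousOn fun s hs => hpath s hs
  have hF : {A | MvPolynomial.eval ![ζ, A] Q = 0}.Finite := hS₁ ζ hζS'
  rcases radial_trichotomy zero_lt_one hu hF with ⟨A, hA⟩ | hinfty | ⟨A, hAF, hAcl⟩
  · -- a finite limit `A` along the radius
    by_cases hQA : Df ζ A = 0
    · -- `Q(ζ, A) = 0`, hence `P(ζ, A) ≠ 0`: an algebraic branch point ("Case 2")
      have hPA : Nf ζ A ≠ 0 := fun hP0 => hS₂ ζ hζS' A hP0 hQA
      set τ : ℕ → ℂ → ℂ := fun k z => exp (log (c - ζ) / k) * exp (log ((ζ - z) / (ζ - c)) / k)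
        with hτ
      have hτpow : ∀ k, 0 < k → ∀ s ∈ Ico (0 : ℝ) 1, τ k (γ s) ^ k = γ s - ζ :=
        fun k hk s hs => root_pow hk hζc (radial_div_mem_slitPlane hζc hs.2)
      have hτcont : ∀ k, 0 < k → ContinuousOn (fun s : ℝ => τ k (γ s)) (Ico (0 : ℝ) 1) :=
        fun k _ => continuousOn_root_radial hζc k
      obtain ⟨k, hk, ρ, hρ, H, hHd, -, -, s₁, -, hs₁, htail⟩ :=
        branch_representation hNan hDan isOpen_ball hw hodeU hζ hr zero_lt_one hpath hPA hA τ
          hτpow hτcont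
      refine representation_of_tail hζ hr hw hk 0 hρ hHd hs₁ fun s hs _ => ?_
      rw [pow_zero, mul_one]
      exact (htail s hs).2
    · -- `Q(ζ, A) ≠ 0`: a regular point ("Case 1")
      exact regular_representation hζ hr hw hNan hDan hodeU hQA hA.mapClusterPt
  · -- `w → ∞` ("Case 5")
    exact infinity_representation hζ hr hw hode hid (hinf ζ hζS') hinfty
  · -- oscillation is excluded: a cluster value off the roots of `Q(ζ, ·)` is regular
    exact regular_representation hζ hr hw hNan hDan hodeU hAF hAcl

end Main

end Literature.Analysis.ODE
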